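import Summits.CriticalPhenomena.PercolationContinuityZ3.Theses.PercExchangeRateTransport
import Summits.CriticalPhenomena.PercolationContinuityZ3.Theorems.PercExchangeRateTransportSubcritExchangeUniformityStubSlopePositiveOnCurve
import HarnessLib

/-!
# Necessity anchor for stub `stub_boxRateAsymptoticLipschitz` of the crux `SupercritExchangeUniformity`
# (K⁺), line `local_exchange_homogeneity` (stmt-CriticalPhenomena-16061): K⁺ ⇒ the box exchange
# rates are asymptotically `L`-Lipschitz in `p` on a closed supercritical collar

The registered stub `stub_boxRateAsymptoticLipschitz` (skeleton
`Cruxes/SupercritExchangeUniformity/Lines/local_exchange_homogeneity.lean`) asks, for the label-coupled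
anisotropic bond family on `ℤ²×ℤ` (route `let` preamble `μ, vert, cfg, Θ, θ, pc`) and every compact
sub-arc `[lo,hi] ⊂ (0,1)`, for `ρ > 0` and `L` such that for every `ε > 0` and all large `R` the box
exchange rates `a_R(p,t) = ∂_tΘ_R(p,t) / ∂_pΘ_R(p,t)` satisfy
`|a_R(p,t) − a_R(q,t)| ≤ L |p − q| + ε` for `t ∈ [lo,hi]` and `p, q ∈ [p_c(t), p_c(t) + ρ]`.
This is the REGULARITY HALF of K⁺ and is open.  This file proves that it is NECESSARY: it follows from
the crux `SupercritExchangeUniformity` itself, so the reshape of the line into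
`russoBlock ∧ partialsContinuous ∧ localHomogeneity ∧ boxRateAsymptoticLipschitz ⟹ K⁺` loses nothing on
this stub.

Proof (`boxRateAsymptoticLipschitz_of_SupercritExchangeUniformity`).  K⁺ on `[lo,hi]` gives `ρ_K`,
`L`, a field `a`, `L`-Lipschitz in `p` on the `ρ_K`-collar, and for every `η > 0` an `m(η)` with
`|∂_tΘ_n − a ∂_pΘ_n| ≤ η ∂_pΘ_n` on the collar for `n ≥ m(η)`.  The landed K⁻ theorems
(`Theorems.SubcritExchangeUniformity.exists_density_thetaPerc_pos`, `pc_mem_Ioo`,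
`thetaBox_deriv_p_pos`; the bookkeeping of the lead's `derivativeFacts_of_stubs` and of the sibling
`RussoPositivity`) give a Russo-positivity collar: a density `q₀ ∈ [0,1)` with `θ(q₀,·) > 0`, whence
`p_c(t) ≤ q₀` (`csInf_le`), and with `ρ_P := (1 − q₀)/2` and `0 < p_c(t)` every point of the
`ρ_P`-collar lies in the open square, where `0 < ∂_pΘ_n` for `n ≥ 1`.  On the collar of width `ρ := min ρ_K ρ_P`, dividing by `∂_pΘ_n > 0`
(`BoxRate.abs_div_sub_le_of_abs_sub_mul_le`) turns the `η`-inequality into `|a_n(p,t) − a(p,t)| ≤ η`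
for `n ≥ max (m η) 1`, whence `|a_R(p,t) − a_R(q,t)| ≤ η + L|p − q| + η`; take `η := ε/2`.

The theorem header is one long line: the gate matches registered stub signatures against the
verbatim header text (`;`-separated `let`s).

References: Aizenman–Grimmett, J. Stat. Phys. 63 (1991) (comparability of pivotal intensities, up
to constants); Chayes–Schonmann, Ann. Appl. Probab. 10 (2000) Thm 1.4 (Lipschitz critical curves);
Balister–Bollobás–Riordan, arXiv:1402.0834.
-/

noncomputable section

open MeasureTheory
open Literature.Probability.Percolation Literature.Probability.LatticeModels
open Summit.CriticalPhenomena.PercolationContinuityZ3.Theorems.SubcritExchangeUniformity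
  (exists_density_thetaPerc_pos pc_mem_Ioo thetaBox_deriv_p_pos)

namespace Summit.CriticalPhenomena.PercolationContinuityZ3.Theorems.SupercritExchangeUniformity

namespace BoxRate

/-- **Dividing an `η`-relative comparison by a positive denominator**: if `0 < d` and
`|x − a·d| ≤ η·d` then `|x/d − a| ≤ η` (used with `x = ∂_tΘ_n`, `d = ∂_pΘ_n`, `a` the limiting
exchange rate). [folklore] -/
theorem abs_div_sub_le_of_abs_sub_mul_le {x a d η : ℝ} (hd : 0 < d) (h : |x - a * d| ≤ η * d) :
    |x / d - a| ≤ η := by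
  have key : x / d - a = (x - a * d) / d := by
    rw [sub_div, mul_div_cancel_right₀ a hd.ne']
  rw [key, abs_div, abs_of_pos hd, div_le_iff₀ hd]
  exact h

/-- **Triangle step**: `|x − y| ≤ |x − b| + |b − c| + |y − c|` (used with `b = a(p,t)`,
`c = a(q,t)`). [folklore] -/
theorem abs_sub_le_three (x y b c : ℝ) : |x - y| ≤ |x - b| + |b - c| + |y - c| := by
  have h1 := abs_sub_le x b y
  have h2 := abs_sub_le b c y
  rw [abs_sub_comm c y] at h2
  linarith

end BoxRate

open BoxRate

/-- **Necessity anchor: K⁺ ⇒ `stub_boxRateAsymptoticLipschitz`.**  If `SupercritExchangeUniformity`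
holds then, for every compact sub-arc `[lo,hi] ⊂ (0,1)`, there are `ρ > 0` and `L` such that for
every `ε > 0` there is `R₀` with
`|∂_tΘ_R(p,t)/∂_pΘ_R(p,t) − ∂_tΘ_R(q,t)/∂_pΘ_R(q,t)| ≤ L |p − q| + ε` for all `R ≥ R₀`,
`t ∈ [lo,hi]` and `p, q ∈ [p_c(t), p_c(t) + ρ]` (the conclusion is the registered stub verbatim).
Proof: `ρ := min ρ_K ((1 − q₀)/2)` (K⁺ collar and the Russo-positivity collar of
`exists_density_thetaPerc_pos` / `pc_mem_Ioo` / `thetaBox_deriv_p_pos`), `L` from K⁺,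
`η := ε/2`, `R₀ := max (m η) 1`; divide the K⁺ `η`-inequality by `∂_pΘ_R > 0` and use the
`L`-Lipschitz bound of the limiting field `a`. [AizenmanGrimmett1991; ChayesSchonmann2000 Thm 1.4] -/
theorem boxRateAsymptoticLipschitz_of_SupercritExchangeUniformity : Summit.CriticalPhenomena.PercolationContinuityZ3.Theses.PercExchangeRateTransport.SupercritExchangeUniformity → let μ := Literature.Probability.Percolation.labelMeasure (Literature.Probability.LatticeModels.Site 3); let vert : Sym2 (Literature.Probability.LatticeModels.Site 3) → Prop := fun e => ∃ x : Literature.Probability.LatticeModels.Site 3, e = s(x, x + Pi.single (2 : Fin 3) 1); let cfg : ℝ → ℝ → (Sym2 (Literature.Probability.LatticeModels.Site 3) → ℝ) → Set (Sym2 (Literature.Probability.LatticeModels.Site 3)) := fun p t U => {e | e ∈ (Literature.Probability.LatticeModels.zdGraph 3).edgeSet ∧ ((vert e ∧ U e ≤ t) ∨ (¬ vert e ∧ U e ≤ p))}; let Θ : ℕ → ℝ → ℝ → ℝ := fun n p t => μ.real {U | cfg p t U ∈ Literature.Probability.Percolation.siteToBoundary 3 n}; let θ : ℝ → ℝ → ℝ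 := fun p t => μ.real {U | cfg p t U ∈ Literature.Probability.Percolation.percolatesAt (0 : Literature.Probability.LatticeModels.Site 3)}; let pc : ℝ → ℝ := fun t => sInf ({p : ℝ | 0 ≤ p ∧ p ≤ 1 ∧ 0 < θ p t} ∪ {1}); ∀ lo hi : ℝ, 0 < lo → lo < hi → hi < 1 → ∃ ρ > (0 : ℝ), ∃ L : ℝ, ∀ ε > (0 : ℝ), ∃ R₀ : ℕ, ∀ R ≥ R₀, ∀ t ∈ Set.Icc lo hi, ∀ p q : ℝ, pc t ≤ p → p ≤ pc t + ρ → pc t ≤ q → q ≤ pc t + ρ → |deriv (fun s => Θ R p s) t / deriv (fun w => Θ R w t) p - deriv (fun s => Θ R q s) t / deriv (fun w => Θ R w t) q| ≤ L * |p - q| + ε := by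
  intro hK μ vert cfg Θ θ pc lo hi hlo hlh hhi
  -- K⁺ on the sub-arc: collar `ρK`, Lipschitz constant `L`, limiting field `a`
  obtain ⟨ρK, hρK, L, a, -, hLip, hη⟩ := hK lo hi hlo hlh hhi
  -- the Russo-positivity collar `ρP := (1 - q₀)/2`: `pc t ≤ q₀ < 1` and `0 < pc t`
  obtain ⟨q₀, hq₀, hq₁, hθq⟩ := exists_density_thetaPerc_pos
  have hpc_le : ∀ t, pc t ≤ q₀ := fun t => by
    refine csInf_le ⟨0, ?_⟩ (Or.inl ⟨hq₀, hq₁.le, hθq t⟩)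
    rintro p (⟨hp, -⟩ | hp)
    · exact hp
    · rw [Set.mem_singleton_iff] at hp; rw [hp]; exact zero_le_one
  have h8 := thetaBox_deriv_p_pos
  have hpos : ∀ n : ℕ, 1 ≤ n → ∀ t ∈ Set.Icc lo hi, ∀ p : ℝ, pc t ≤ p → p ≤ pc t + (1 - q₀) / 2 →
      0 < deriv (fun q => Θ n q t) p := by
    intro n hn t ht p hp1 hp2
    have ht' : t ∈ Set.Ioo (0 : ℝ) 1 := ⟨hlo.trans_le ht.1, ht.2.trans_lt hhi⟩
    have h0 : 0 < pc t := (pc_mem_Ioo t ht').1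
    have h1 := hpc_le t
    have hp : p ∈ Set.Ioo (0 : ℝ) 1 := ⟨h0.trans_le hp1, by linarith⟩
    exact h8 n hn p hp t ht'
  have hρP : 0 < (1 - q₀) / 2 := by linarith
  refine ⟨min ρK ((1 - q₀) / 2), lt_min hρK hρP, L, fun ε hε => ?_⟩
  obtain ⟨m, hm⟩ := hη (ε / 2) (half_pos hε)
  refine ⟨max m 1, fun R hR t ht p q hp1 hp2 hq1 hq2 => ?_⟩
  have hRm : m ≤ R := le_of_max_le_left hR
  have hR1 : 1 ≤ R := le_of_max_le_right hR
  have hp2K : p ≤ pc t + ρK := hp2.trans (by gcongr; exact min_le_left _ _)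
  have hp2P : p ≤ pc t + (1 - q₀) / 2 := hp2.trans (by gcongr; exact min_le_right _ _)
  have hq2K : q ≤ pc t + ρK := hq2.trans (by gcongr; exact min_le_left _ _)
  have hq2P : q ≤ pc t + (1 - q₀) / 2 := hq2.trans (by gcongr; exact min_le_right _ _)
  -- positive denominators
  have hdp : 0 < deriv (fun w => Θ R w t) p := hpos R hR1 t ht p hp1 hp2P
  have hdq : 0 < deriv (fun w => Θ R w t) q := hpos R hR1 t ht q hq1 hq2P
  -- `|a_R − a| ≤ ε/2` at `p` and at `q`
  have hap : |deriv (fun s => Θ R p s) t / deriv (fun w => Θ R w t) p - a p t| ≤ ε / 2 :=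
    abs_div_sub_le_of_abs_sub_mul_le hdp (hm R hRm t ht p hp1 hp2K)
  have haq : |deriv (fun s => Θ R q s) t / deriv (fun w => Θ R w t) q - a q t| ≤ ε / 2 :=
    abs_div_sub_le_of_abs_sub_mul_le hdq (hm R hRm t ht q hq1 hq2K)
  -- the Lipschitz bound of the limiting field
  have hL : |a p t - a q t| ≤ L * |p - q| := hLip t ht p q hp1 hp2K hq1 hq2K
  have h3 := abs_sub_le_three (deriv (fun s => Θ R p s) t / deriv (fun w => Θ R w t) p)
    (deriv (fun s => Θ R q s) t / deriv (fun w => Θ R w t) q) (a p t) (a q t)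
  linarith

end Summit.CriticalPhenomena.PercolationContinuityZ3.Theorems.SupercritExchangeUniformity

end
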